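import Summits.AtomisticToContinuum.Crystallization.Theorems.FrustratedLawDichotomyTwoShellRigidityOctaCell
import Summits.AtomisticToContinuum.Crystallization.Theorems.FrustratedLawDichotomyTwoShellRigidityExtraction

/-!
# FrustratedLawDichotomy · `OctaCellAt 18` for both kissing patterns, and `R ⟸ FrameAssembly` alone

The pattern-level packaging of `FrustratedLawDichotomyTwoShellRigidityOctaCell.octa_fit` (near-regular octahedron, all five
deviations `≤ 18·θ·d`): `octaCellAt_fcc`, `octaCellAt_hcp`, `octaCellAt_mono`; together with `TetraCellAt 11` (p821511) and
`Extraction θ` (p820807) this discharges every piece of lens-5's split of `R = CoarseCappedRigidity K θ`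
(`FrustratedLawDichotomyTwoShellRigidityCells`) EXCEPT the frame assembly:
`coarseCappedRigidity_of_frameAssembly : 18 ≤ c → FrameAssemblyAt K c fcc → FrameAssemblyAt K c hcp → CoarseCappedRigidity K θ`
for every `0 < θ ≤ 1/100`.  No `sorry`, no defs.
-/

noncomputable section

namespace Summit.AtomisticToContinuum.Crystallization.Theorems.FrustratedLawDichotomyTwoShellRigidityOctaCellAt

open Literature.Geometry.DiscreteGeometry
open Summit.AtomisticToContinuum.Crystallization.Theorems.FrustratedLawDichotomyTwoShellRigidityCut (E3)
open Summit.AtomisticToContinuum.Crystallization.Theorems.FrustratedLawDichotomyTwoShellRigidityCells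
open Summit.AtomisticToContinuum.Crystallization.Theorems.FrustratedLawDichotomyTwoShellRigidityTetraCell (cellLemmas_tetra)
open Summit.AtomisticToContinuum.Crystallization.Theorems.FrustratedLawDichotomyTwoShellRigidityExtraction
  (coarseCappedRigidity_of_cellLemmas aperiodicFrustratedLawGap_of_cellLemmas_of_basin
    noFrustratedPeriodicMinimiser_of_cellLemmas_of_basin)
open Summit.AtomisticToContinuum.Crystallization.Theorems.FrustratedLawDichotomyTwoShellRigidityOctaCell (octa_fit)

/-! ## The cell lemma `OctaCellAt 18` for both kissing patterns -/

/-- **`OctaCellAt 18 Pat` for every pattern of unit vectors** (in particular both kissing patterns). [folklore] -/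
theorem octaCellAt_of_norm_one {Pat : Finset E3} (h1 : ∀ z ∈ Pat, ‖z‖ = 1) : OctaCellAt 18 Pat := by
  intro θ d hθ0 hθ1 hd u v w w' huv hwu hwv hw'u hw'v hww' p q hrad hside hcap hdu hdw hq
  obtain ⟨hu1, hu2⟩ := hrad u (Or.inl rfl)
  obtain ⟨hv1, hv2⟩ := hrad v (Or.inr (Or.inl rfl))
  obtain ⟨hw1, hw2⟩ := hrad w (Or.inr (Or.inr (Or.inl rfl)))
  obtain ⟨hw'1, hw'2⟩ := hrad w' (Or.inr (Or.inr (Or.inr rfl)))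
  obtain ⟨huw1, huw2⟩ := hside u w (Or.inl rfl) (Or.inl rfl)
  obtain ⟨huw'1, huw'2⟩ := hside u w' (Or.inl rfl) (Or.inr rfl)
  obtain ⟨hvw1, hvw2⟩ := hside v w (Or.inr rfl) (Or.inl rfl)
  obtain ⟨hvw'1, hvw'2⟩ := hside v w' (Or.inr rfl) (Or.inr rfl)
  obtain ⟨hqu1, hqu2⟩ := hcap u (Or.inl rfl)
  obtain ⟨hqv1, hqv2⟩ := hcap v (Or.inr (Or.inl rfl))
  obtain ⟨hqw1, hqw2⟩ := hcap w (Or.inr (Or.inr (Or.inl rfl)))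
  obtain ⟨hqw'1, hqw'2⟩ := hcap w' (Or.inr (Or.inr (Or.inr rfl)))
  obtain ⟨A, hA, hB, hC, hD, hQ⟩ := octa_fit (h1 _ u.2) (h1 _ v.2) (h1 _ w.2) (h1 _ w'.2) huv hwu hwv hw'u hw'v hww' hθ0 hθ1 hd
    hu1 hu2 hv1 hv2 hw1 hw2 hw'1 hw'2 huw1 huw2 huw'1 huw'2 hvw1 hvw2 hvw'1 hvw'2 hqu1 hqu2 hqv1 hqv2 hqw1 hqw2 hqw'1 hqw'2
    hdu hdw hq
  refine ⟨A, ?_, hQ⟩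
  rintro z (rfl | rfl | rfl | rfl)
  exacts [hA, hB, hC, hD]

/-- **`OctaCellAt 18 fccKissingPattern`.** [folklore] -/
theorem octaCellAt_fcc : OctaCellAt 18 fccKissingPattern :=
  octaCellAt_of_norm_one fun _ hz => norm_eq_one_of_mem_fccKissingPattern hz

/-- **`OctaCellAt 18 hcpKissingPattern`.** [folklore] -/
theorem octaCellAt_hcp : OctaCellAt 18 hcpKissingPattern :=
  octaCellAt_of_norm_one fun _ hz => norm_eq_one_of_mem_hcpKissingPattern hz

/-- Monotonicity of the octahedral cell lemma in its constant. [folklore] -/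
theorem octaCellAt_mono {c c' : ℝ} {Pat : Finset E3} (hle : c ≤ c') (h : OctaCellAt c Pat) : OctaCellAt c' Pat := by
  intro θ d hθ0 hθ1 hd u v w w' huv hwu hwv hw'u hw'v hww' p q hrad hside hcap hdu hdw hq
  obtain ⟨A, hA, hQ⟩ := h θ d hθ0 hθ1 hd u v w w' huv hwu hwv hw'u hw'v hww' p q hrad hside hcap hdu hdw hq
  have hθd : 0 ≤ θ * d := by positivity
  have hcc : c * θ * d ≤ c' * θ * d := by nlinarith
  exact ⟨A, fun z hz => (hA z hz).trans hcc, hQ.trans hcc⟩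

/-- **Two of the three cell pieces of `CellLemmas K c`, for every `c ≥ 18`**: the tetrahedral and the octahedral cells at both kissing
patterns (`cellLemmas_tetra`, p821511, and this file).  What remains of lens-5's `CellLemmas K c` is `FrameAssemblyAt K c` (both
patterns); then `coarseCappedRigidity_of_cells` gives `R = CoarseCappedRigidity K θ` for every `0 < θ ≤ 1/100`. [folklore] -/
theorem cellLemmas_tetra_octa {c : ℝ} (hc : 18 ≤ c) :
    (TetraCellAt c fccKissingPattern ∧ TetraCellAt c hcpKissingPattern) ∧
      (OctaCellAt c fccKissingPattern ∧ OctaCellAt c hcpKissingPattern) :=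
  ⟨cellLemmas_tetra (by linarith), octaCellAt_mono hc octaCellAt_fcc, octaCellAt_mono hc octaCellAt_hcp⟩

/-- **`CellLemmas K c` from the frame assembly alone** (`c ≥ 18`): `FrameAssemblyAt K c` at both patterns ⟹ `CellLemmas K c`.
[folklore] -/
theorem cellLemmas_of_frameAssembly {K c : ℝ} (hc : 18 ≤ c) (hF : FrameAssemblyAt K c fccKissingPattern)
    (hH : FrameAssemblyAt K c hcpKissingPattern) : CellLemmas K c :=
  ⟨(cellLemmas_tetra_octa hc).1, (cellLemmas_tetra_octa hc).2, hF, hH⟩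

/-- **R from the frame assembly alone**: `FrameAssemblyAt K c` (both patterns, some `c ≥ 18`) ⟹ `CoarseCappedRigidity K θ` for every
`0 < θ ≤ 1/100` (extraction p820807 + the two cell lemmas + lens-5's glue). [folklore] -/
theorem coarseCappedRigidity_of_frameAssembly {K c θ : ℝ} (hc : 18 ≤ c) (hθ0 : 0 < θ) (hθ1 : θ ≤ 1 / 100)
    (hF : FrameAssemblyAt K c fccKissingPattern) (hH : FrameAssemblyAt K c hcpKissingPattern) : CoarseCappedRigidity K θ :=
  coarseCappedRigidity_of_cellLemmas hθ0 hθ1 (cellLemmas_of_frameAssembly hc hF hH)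

/-! ## By name: the FLD column with both cell lemmas discharged — what is left of R is the frame assembly -/

/-- **Crux of item 27623 BY NAME with `Extraction`, `TetraCell`, `OctaCell` discharged** (literal `θ = 1/100`):
`MuEquilibriumDoor ∧ ChargedEnergyGap ∧ G(1/100) ∧ P(1/100) ∧ FrameAssemblyAt K c (fcc, hcp; c ≥ 18) ∧ BasinCertificate K (1/100) (1/20)
⟹ AperiodicFrustratedLawGap`. [folklore] -/
theorem aperiodicFrustratedLawGap_of_frameAssembly_of_basin {K c : ℝ} (hc : 18 ≤ c)
    (hDoor : Summit.AtomisticToContinuum.Crystallization.Theses.GrainCoreNetworkSplit.MuEquilibriumDoor)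
    (hgap : Summit.AtomisticToContinuum.Crystallization.Theses.PricedLinkCensus.ChargedEnergyGap)
    (hG : Summit.AtomisticToContinuum.Crystallization.Theorems.FrustratedLawDichotomyTwoShellRigidityCut.LinkClassification (1 / 100))
    (hP : Summit.AtomisticToContinuum.Crystallization.Theorems.FrustratedLawDichotomyTwoShellRigidityCut.CapForcing (1 / 100))
    (hF : FrameAssemblyAt K c fccKissingPattern) (hH : FrameAssemblyAt K c hcpKissingPattern)
    (hL : BasinCertificate K (1 / 100) (1 / 20)) :
    Summit.AtomisticToContinuum.Crystallization.Theses.FrustratedLawDichotomy.AperiodicFrustratedLawGap :=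
  aperiodicFrustratedLawGap_of_cellLemmas_of_basin hDoor hgap hG hP (cellLemmas_of_frameAssembly hc hF hH) hL

/-- **Item 26654 `NoFrustratedPeriodicMinimiser`, door-free, with `Extraction`, `TetraCell`, `OctaCell` discharged.** [folklore] -/
theorem noFrustratedPeriodicMinimiser_of_frameAssembly_of_basin {K c : ℝ} (hc : 18 ≤ c)
    (hgap : Summit.AtomisticToContinuum.Crystallization.Theses.PricedLinkCensus.ChargedEnergyGap)
    (hG : Summit.AtomisticToContinuum.Crystallization.Theorems.FrustratedLawDichotomyTwoShellRigidityCut.LinkClassification (1 / 100))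
    (hP : Summit.AtomisticToContinuum.Crystallization.Theorems.FrustratedLawDichotomyTwoShellRigidityCut.CapForcing (1 / 100))
    (hF : FrameAssemblyAt K c fccKissingPattern) (hH : FrameAssemblyAt K c hcpKissingPattern)
    (hL : BasinCertificate K (1 / 100) (1 / 20)) :
    Summit.AtomisticToContinuum.Crystallization.Theses.PeriodicChargeSplit.NoFrustratedPeriodicMinimiser :=
  noFrustratedPeriodicMinimiser_of_cellLemmas_of_basin hgap hG hP (cellLemmas_of_frameAssembly hc hF hH) hL

/-- **The θ-DIAL with the cells discharged (certificate-free below the crossover)**: for `0 < θ ≤ 1/100` with `K·θ < 1/20`,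
`MuEquilibriumDoor ∧ PriceTol θ ∧ G θ ∧ P θ ∧ FrameAssemblyAt K c (fcc, hcp; c ≥ 18) ⟹ AperiodicFrustratedLawGap`. [folklore] -/
theorem aperiodicFrustratedLawGap_of_price_of_frameAssembly {K c θ : ℝ} (hc : 18 ≤ c) (hθ0 : 0 < θ) (hθ1 : θ ≤ 1 / 100)
    (hK : K * θ < 1 / 20)
    (hDoor : Summit.AtomisticToContinuum.Crystallization.Theses.GrainCoreNetworkSplit.MuEquilibriumDoor) (hprice : PriceTol θ)
    (hG : Summit.AtomisticToContinuum.Crystallization.Theorems.FrustratedLawDichotomyTwoShellRigidityCut.LinkClassification θ)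
    (hP : Summit.AtomisticToContinuum.Crystallization.Theorems.FrustratedLawDichotomyTwoShellRigidityCut.CapForcing θ)
    (hF : FrameAssemblyAt K c fccKissingPattern) (hH : FrameAssemblyAt K c hcpKissingPattern) :
    Summit.AtomisticToContinuum.Crystallization.Theses.FrustratedLawDichotomy.AperiodicFrustratedLawGap :=
  aperiodicFrustratedLawGap_of_price_of_coarse hθ0 hθ1 hK hDoor hprice hG hP
    (coarseCappedRigidity_of_frameAssembly hc hθ0 hθ1 hF hH)

/-- **θ-DIAL, door-free sibling (item 26654)** with the cells discharged. [folklore] -/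
theorem noFrustratedPeriodicMinimiser_of_price_of_frameAssembly {K c θ : ℝ} (hc : 18 ≤ c) (hθ0 : 0 < θ) (hθ1 : θ ≤ 1 / 100)
    (hK : K * θ < 1 / 20) (hprice : PriceTol θ)
    (hG : Summit.AtomisticToContinuum.Crystallization.Theorems.FrustratedLawDichotomyTwoShellRigidityCut.LinkClassification θ)
    (hP : Summit.AtomisticToContinuum.Crystallization.Theorems.FrustratedLawDichotomyTwoShellRigidityCut.CapForcing θ)
    (hF : FrameAssemblyAt K c fccKissingPattern) (hH : FrameAssemblyAt K c hcpKissingPattern) :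
    Summit.AtomisticToContinuum.Crystallization.Theses.PeriodicChargeSplit.NoFrustratedPeriodicMinimiser :=
  noFrustratedPeriodicMinimiser_of_price_of_coarse hθ0 hθ1 hK hprice hG hP (coarseCappedRigidity_of_frameAssembly hc hθ0 hθ1 hF hH)

end Summit.AtomisticToContinuum.Crystallization.Theorems.FrustratedLawDichotomyTwoShellRigidityOctaCellAt

end
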